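import Summits.CriticalPhenomena.PercolationContinuityZ3.Theorems.FK.PlanarDualityWiredDual
import Summits.CriticalPhenomena.PercolationContinuityZ3.Theorems.FK.UniquenessOfNonPercolationTheta
import HarnessLib

/-!
# Planar duality of the random-cluster model, VI: where `φ⁰_{p,q} ≠ φ¹_{p,q}` can happen on `ℤ²`
# (Grimmett 2006, §6.2: Thm. (6.17)(b) from (6.17)(a) by duality)

Claimed R42 (8)(c) in the cell INBOX at 2026-08-27T19:32:51Z by fkp-10a gen 350 (NEW CLAIM #4 of the gen), addressed to coordinator fk-4 g260 (seated 17:10Z 2026-08-27; R137 l.8093, R138 l.8113, (κ) word l.8150, CLAIM #3 l.8154); lineage row FO-10a-g350u (self-suggested), package g350-dualuniq, label UR-A.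
Support file of the `fk-continuity` cell (lineage fkp-10a, `--supports stmt-CriticalPhenomena-4575`); builds on
p205010 (kernel theorem, internal audit signed; external expert review pending).  No definitions, no named facts,
no sorries; standard axioms.  `d = 2`, `0 ≤ p ≤ 1`, `q ≥ 1`.

The non-uniqueness set `𝒟 = {p : φ⁰_{p,q} ≠ φ¹_{p,q}}` of the square lattice is invariant under `p ↦ p_d`
(`rcLimit_false_eq_rcLimit_true_iff_dual`, `PlanarDualityWiredDual.lean`) and misses `[0, p_c(q))`
(`rcLimit_false_eq_rcLimit_true_of_lt_rcCriticalProb`, θ¹ = 0 below `p_c(q)`).  Hence, UNCONDITIONALLY: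

* `rcLimit_false_eq_rcLimit_true_of_dual_lt_rcCriticalProb` — uniqueness whenever `p_d < p_c(q)`;
* `rcCriticalProb_le_and_le_dual_of_ne` — phase coexistence at `p` forces `p_c(q) ≤ p` AND `p_c(q) ≤ p_d`;
* **`rcCriticalProb_le_selfDual_of_ne`** — phase coexistence at ANY `p` forces `p_c(q) ≤ p_sd(q) = √q/(1+√q)`
  (one of `p`, `p_d` is `≤ p_sd`);
and, CONDITIONALLY on Thm. (6.17)(a) `p_sd(q) ≤ p_c(q)` (Zhang's argument — NOT proved here, taken as a hypothesis):
* **`rcLimit_false_eq_rcLimit_true_of_ne_selfDual`** — Thm. (6.17)(b): `φ⁰_{p,q} = φ¹_{p,q}` for every `p ≠ p_sd(q)`;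
  `setOf_rcLimit_ne_subset_selfDual` (`𝒟 ⊆ {p_sd(q)}`), `thetaFree_eq_thetaWired_of_ne_selfDual`,
  `freeEdgeDensity_eq_wiredEdgeDensity_of_ne_selfDual`.

Nothing here decides `p_c(q)` vs `p_sd(q)`, FH / TP_FK, or the cell's `d ≥ 3` target.

## References

* G. Grimmett, *The Random-Cluster Model*, Springer 2006: §6.2 Thm. (6.17) and its proof ((b) from (a) by
  Thm. (6.13)); Thm. (5.16), Thm. (4.63). [Grimmett2006]
* G. Grimmett, *Percolation*, 2nd ed., Springer 1999, §11.2. [GrimmettPercolation1999]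
-/

noncomputable section

open scoped Classical Topology
open MeasureTheory Finset Filter

namespace Summit.CriticalPhenomena.PercolationContinuityZ3.Theorems

namespace FK

open Literature.Probability.LatticeModels Literature.Probability.Percolation
  Literature.Barriers.CriticalPhenomena

variable {p q : ℝ}

/-! ### Unconditional consequences of `𝒟 = 𝒟_d` and `𝒟 ∩ [0, p_c(q)) = ∅` -/

/-- **Uniqueness whenever the dual parameter is subcritical**: `p_d < p_c(q) ⇒ φ⁰_{p,q} = φ¹_{p,q}` on `ℤ²`.
[cite: Grimmett2006, §6.2 proof of Thm. (6.17)(b); Thm. (5.16)] -/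
theorem rcLimit_false_eq_rcLimit_true_of_dual_lt_rcCriticalProb (hp : p ∈ Set.Icc (0 : ℝ) 1) (hq : 1 ≤ q)
    (hlt : rcDualParam p q < rcCriticalProb 2 q) : rcLimit 2 false p q = rcLimit 2 true p q :=
  (rcLimit_false_eq_rcLimit_true_iff_dual hp hq).2
    (rcLimit_false_eq_rcLimit_true_of_lt_rcCriticalProb hq (rcDualParam_mem_Icc hp (one_pos.trans_le hq)).1 hlt)

/-- **Phase coexistence at `p` forces `p_c(q) ≤ p` and `p_c(q) ≤ p_d`.** [cite: Grimmett2006, §6.2 proof of Thm. (6.17)(b); §5.2 p. 102] -/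
theorem rcCriticalProb_le_and_le_dual_of_ne (hp : p ∈ Set.Icc (0 : ℝ) 1) (hq : 1 ≤ q)
    (hne : rcLimit 2 false p q ≠ rcLimit 2 true p q) :
    rcCriticalProb 2 q ≤ p ∧ rcCriticalProb 2 q ≤ rcDualParam p q :=
  ⟨rcCriticalProb_le_of_rcLimit_false_ne_rcLimit_true hp hq hne,
    le_of_not_gt fun hlt => hne (rcLimit_false_eq_rcLimit_true_of_dual_lt_rcCriticalProb hp hq hlt)⟩

/-- **Phase coexistence anywhere on `ℤ²` forces `p_c(q) ≤ p_sd(q) = √q/(1+√q)`**: if `φ⁰_{p,q} ≠ φ¹_{p,q}` for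
some `p ∈ [0,1]`, then `p_c(q) ≤ min(p, p_d) ≤ p_sd(q)`. [cite: Grimmett2006, §6.1 (6.8)–(6.9), §6.2 Thm. (6.17)] -/
theorem rcCriticalProb_le_selfDual_of_ne (hp : p ∈ Set.Icc (0 : ℝ) 1) (hq : 1 ≤ q)
    (hne : rcLimit 2 false p q ≠ rcLimit 2 true p q) :
    rcCriticalProb 2 q ≤ Real.sqrt q / (1 + Real.sqrt q) := by
  have hq0 : 0 < q := one_pos.trans_le hq
  obtain ⟨h1, h2⟩ := rcCriticalProb_le_and_le_dual_of_ne hp hq hne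
  by_cases h : Real.sqrt q / (1 + Real.sqrt q) < p
  · exact h2.trans ((rcDualParam_lt_iff hp hq0).2 h).le
  · exact h1.trans (not_lt.1 h)

/-! ### Thm. (6.17)(b), conditionally on (6.17)(a) `p_sd(q) ≤ p_c(q)` -/

/-- **Grimmett 2006, Thm. (6.17)(b), conditionally on (a)**: if `p_sd(q) ≤ p_c(q)` (part (a), Zhang's argument —
a hypothesis here), then `φ⁰_{p,q} = φ¹_{p,q}` for every `p ∈ [0,1]` with `p ≠ p_sd(q)`: below `p_sd` because
`p < p_c(q)`, above because `p_d < p_sd ≤ p_c(q)` and `𝒟 = 𝒟_d`. [cite: Grimmett2006, §6.2 Thm. (6.17)(b) and its proof] -/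
theorem rcLimit_false_eq_rcLimit_true_of_ne_selfDual (hp : p ∈ Set.Icc (0 : ℝ) 1) (hq : 1 ≤ q)
    (hsd : Real.sqrt q / (1 + Real.sqrt q) ≤ rcCriticalProb 2 q) (hne : p ≠ Real.sqrt q / (1 + Real.sqrt q)) :
    rcLimit 2 false p q = rcLimit 2 true p q := by
  have hq0 : 0 < q := one_pos.trans_le hq
  rcases lt_or_gt_of_ne hne with hlt | hgt
  · exact rcLimit_false_eq_rcLimit_true_of_lt_rcCriticalProb hq hp.1 (hlt.trans_le hsd)
  · exact rcLimit_false_eq_rcLimit_true_of_dual_lt_rcCriticalProb hp hq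
      (((rcDualParam_lt_iff hp hq0).2 hgt).trans_le hsd)

/-- Under (6.17)(a): the non-uniqueness set of `ℤ²` is contained in `{p_sd(q)}`. [cite: Grimmett2006, §6.2 Thm. (6.17)(b)] -/
theorem setOf_rcLimit_ne_subset_selfDual (hq : 1 ≤ q) (hsd : Real.sqrt q / (1 + Real.sqrt q) ≤ rcCriticalProb 2 q) :
    {p : ℝ | p ∈ Set.Icc (0 : ℝ) 1 ∧ rcLimit 2 false p q ≠ rcLimit 2 true p q} ⊆
      {Real.sqrt q / (1 + Real.sqrt q)} := by
  rintro p ⟨hp, hne⟩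
  by_contra h
  exact hne (rcLimit_false_eq_rcLimit_true_of_ne_selfDual hp hq hsd h)

/-- Under (6.17)(a): `θ⁰(p,q) = θ¹(p,q)` for every `p ≠ p_sd(q)`. [cite: Grimmett2006, §6.2 Thm. (6.17)(b); Thm. (5.16)] -/
theorem thetaFree_eq_thetaWired_of_ne_selfDual (hp : p ∈ Set.Icc (0 : ℝ) 1) (hq : 1 ≤ q)
    (hsd : Real.sqrt q / (1 + Real.sqrt q) ≤ rcCriticalProb 2 q) (hne : p ≠ Real.sqrt q / (1 + Real.sqrt q)) :
    thetaFree 2 p q = thetaWired 2 p q :=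
  thetaFree_eq_thetaWired_of_rcLimit_false_eq_rcLimit_true hp hq
    (rcLimit_false_eq_rcLimit_true_of_ne_selfDual hp hq hsd hne)

/-- Under (6.17)(a): `h⁰(p,q) = h¹(p,q)` at every lattice edge for every `p ≠ p_sd(q)`.
[cite: Grimmett2006, §6.2 Thm. (6.17)(b); Thm. (4.63)] -/
theorem freeEdgeDensity_eq_wiredEdgeDensity_of_ne_selfDual (hp : p ∈ Set.Icc (0 : ℝ) 1) (hq : 1 ≤ q)
    (hsd : Real.sqrt q / (1 + Real.sqrt q) ≤ rcCriticalProb 2 q) (hne : p ≠ Real.sqrt q / (1 + Real.sqrt q))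
    {e : Sym2 (Site 2)} (he : e ∈ (zdGraph 2).edgeSet) :
    freeEdgeDensity 2 p q e = wiredEdgeDensity 2 p q e :=
  edgeDensity_eq_of_rcLimit_false_eq_rcLimit_true hp hq
    (rcLimit_false_eq_rcLimit_true_of_ne_selfDual hp hq hsd hne) he

end FK

end Summit.CriticalPhenomena.PercolationContinuityZ3.Theorems

end
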